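import Literature.MathematicalPhysics.QuantumFieldTheory.BalabanImbrieJaffe1984to88.BIJ85Sigma421Torus
import Literature.MathematicalPhysics.QuantumFieldTheory.BalabanImbrieJaffe1984to88.BIJ85NoZeroModes309Torus
import Literature.MathematicalPhysics.QuantumFieldTheory.Balaban1983to89.B5HierAxialGaugeV1

/-!
# `BalabanImbrieJaffe1984to88.BIJ85SigmaGaugeInvariance` — T. Bałaban, J. Imbrie, A. Jaffe, *Renormalization of the Higgs
model: minimizers, propagators and the stability of mean field theory*, Commun. Math. Phys. **97** (1985) 299–329
[BalabanImbrieJaffe1985]: Sect. 4.2 p. 310 — *"The right side of (4.2.2) involves the combination ∂G_{k,Ax}∂^* which is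
invariant under a change of gauge. Hence the gauge chosen to define σ_k is irrelevant, and the quadratic form σ_k is gauge
invariant."* — PROVED for δ-function gauges, abstractly and on the tori of the series (where the k-axial gauge is shown to be
ACCESSIBLE from every field with `Q_kA = 0` by a restricted gauge transformation)

statement-level skeleton of published theorems with citation tags; proofs where landed; nothing here is a claim about the Yang–Mills mass gap

PDF held: `paper:balaban1985-cmp97-bij-higgs-minimizers` (journal page = PDF page + 298); p. 309–311 [PDF 11–13] read on the
renders `run/shared/lean/pub/pub-balaban/t4/b2b-balaban-t4-lit2/renders/bij1985/1985-cmp97-bij-higgs-minimizers-p012-x2.png`,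
`…-p013-x2.png` and the text layer `p0011.txt`.

CITATION HEADER (lean-in-tree rule).  Part of the lit-balaban TYPED SKELETON (HOME `run/shared/lean/pub/lit-balaban/`).
WHAT IS REPRODUCED = the p. 310 gauge-invariance sentence attached to SKELETON row **C1.Eq4.2.1-4.2.2** (owner r15,
`HOME/lit-balaban-r15/ROWS-C1.md`: *"∂G_{k,Ax}∂^* gauge invariant ⇒ σ_k gauge invariant (used in Sect. 7)"*, no declaration
before this file), in the setting of record of that row: p09's `BIJ85SigmaForm421` ((4.2.1) `IsSigmaForm`, (4.2.2) `sigmaOp`,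
`curlG = ∂G_{k,Ax}∂^*`) and p30 g3's torus instance `BIJ85Sigma421Torus.sigmaTorus`.  Phase-2 proof seat p33 gen 3
(unit `lit-balaban-p33`; gens 1–2 = `BIJ85NoZeroModes309Proof/KProof/Torus/TorusPart2`, `BIJ85AxialEdgeRigidity`,
`BIJ85SigmaPositivity`, `BIJ85Ineq423Torus`); TAKING line HOME/STATUS.md 2026-08-21T05:21:38Z; referee ref-5.

THE PRINTED TEXT (verbatim, p. 310 [PDF 12]).  *"Clearly σ_k is related to the propagator G_{k,Ax} of Sect. 4.1. Comparing
(4.2.1) with (4.1.1) we find σ_k = Q^e_k(I − ∂G_{k,Ax}∂^*)Q^{e*}_k = η^{−2}I − Q^e_k∂G_{k,Ax}∂^*Q^{e*}_k. (4.2.2) Here we have used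
Q^e_kQ^{e*}_k = η^{−2}, see (2.24). Note that if k = 1, then G_{k,Ax} = C and (4.2.2) agrees with (3.21). The right side of
(4.2.2) involves the combination ∂G_{k,Ax}∂^* which is invariant under a change of gauge. Hence the gauge chosen to define σ_k is
irrelevant, and the quadratic form σ_k is gauge invariant. We use this property in Sect. 7 when we derive an explicit
momentum-space representation for σ_k."*  And p. 309 [PDF 11], the objects: *"Define G_{k,Ax} by the functional integral
exp(½⟨J, G_{k,Ax}J⟩) = Z_{k,Ax}^{−1}∫𝒟Aδ(Q_kA)δ_{k,Ax}(A)exp(−½‖∂A‖² + ⟨A, J⟩). (4.1.1) … Finally, the axial gauge is fixed by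
the delta function δ_{k,Ax}(A) ≡ Π_{j=0}^{k−1}δ_{Ax}(Q_jA). (4.1.2)"*.

WHAT IS PROVED HERE (0 `sorry`, standard axioms, theorems only; kind «knitting / model instance»).
§1 ABSTRACT, in p09's framework (`E` = η-bond fields, `F` = η-plaquette fields, `D = ∂`, a δ-function GAUGE = the linear
subspace `V ≤ E` over which (4.1.1)/(4.2.1) integrate, `curlG V D = ∂G_V∂^*` with `G_V = axialPropagator V D`):
* `curlG_eq_of_map_eq` — **`∂G_V∂^*` depends on the gauge `V` only through `∂V`**: if `V`, `V′` have no zero modes of `∂` and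
  `∂V = ∂V′` then `∂G_V∂^* = ∂G_{V′}∂^*` (both are the orthogonal projection onto `∂V`; p09's `curlG_idem/symm/apply_curl/mem_range`);
* `curlG_eq_of_gauge` — *"invariant under a change of gauge"*: the same conclusion when `V ≤ V′ ⊔ 𝒢` and `V′ ≤ V ⊔ 𝒢` for a
  space `𝒢` of gauge directions killed by `∂` (`𝒢 ≤ ker ∂`, e.g. the gradients `∂λ`);
* `sigmaOp_eq_of_map_eq` / `sigmaOp_eq_of_gauge` — *"Hence the gauge chosen to define σ_k is irrelevant"* for the operator (4.2.2),
  and `form_eq_of_isSigmaForm_of_map_eq` — the same at the level of the DEFINITION (4.2.1): two operators σ, σ′ satisfying the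
  functional-integral identity (4.2.1) over two such gauges have the same quadratic form `⟨f, σf⟩ = ⟨f, σ′f⟩`.
§2 ON THE TORI of the series (`LatticeFieldCalculus`, p09's `BondSpace`/`PlaqSpace`/`curlOp w c`/`V411 P k`, p30 g3's
`QesOp`/`sigmaTorus`; standing range `k ≤ m + K`, `w > 0`, lattice factor `c ≠ 0`):
* `exists_gaugeShift_mem_constraint411` — **the k-axial gauge is ACCESSIBLE inside the constraint `δ(Q_kA)`**: every `A` with
  `Q_kA = 0` is carried by a restricted gauge transformation `λ ∈ N(Q′_k)` (`Q′_kλ = 0`) to `A^λ = A − ∂λ ∈ δ(Q_kA)δ_{k,Ax}(A)`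
  — p37's hierarchical block-axial gauge `B5HierAxialGaugeV1.hierAxial_exists` ([Balaban1984PropagatorsI] (1.23)) + p38's
  `B5Eq120IterProof.bondAvgIter_gaugeShift_of_null` ((1.20): `Q′_kλ = 0 ⇒ Q_kA^λ = Q_kA`); `∂A^λ = ∂A` (`curlOp_toE_gaugeShift`);
* `map_curlOp_V411_eq_of_gauge` — hence `∂(V411 k) = ∂V′` for EVERY gauge `V′` inside `{Q_kA = 0}` that is accessible (every
  `Q_k`-null field has a `V′`-representative with the same plaquette variables, e.g. a gauge transform: `accessible_of_gaugeFixing`);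
* **`curlG_eq_curlG_V411`**, **`sigmaOp_eq_sigmaTorus`**, **`form_eq_sigmaTorus_of_isSigmaForm`** — for every such gauge `V′`
  without zero modes: `∂G_{V′}∂^* = ∂G_{k,Ax}∂^*`, `Q^e_k(I − ∂G_{V′}∂^*)Q^{e*}_k = σ_k` (= `sigmaTorus`), and every σ′ DEFINED BY
  (4.2.1) with the gauge `V′` in place of `δ_{k,Ax}` has `⟨f, σ′f⟩ = ⟨f, σ_kf⟩`; the axial gauge itself qualifies
  (`V411_isAccessibleGauge`, with the no-zero-modes theorem of this seat's gen 2, `BIJ85NoZeroModes309Torus`).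
HONEST SCOPE.  "Gauge" = δ-function gauge (a linear subspace of the fields, as δ_{k,Ax} in (4.1.1)/(4.2.1)); the WEIGHTED Landau
gauge `𝒢(∂^*A)` of (4.4.1)–(4.4.3) is not a subspace and its version of the sentence is Proposition 5.2.2 / Remark 1 (5.2.6),
(5.2.10) (rows C1.Prop5.2.2, C1.Rem@317, proved elsewhere in the tree under their printed inputs), not this file.  The
momentum-space use in Sect. 7 is not touched.  No new `def`; nothing is asserted beyond the kernel-checked statements below.
-/

namespace Literature.MathematicalPhysics.QuantumFieldTheory.BalabanImbrieJaffe1984to88.BIJ85SigmaGaugeInvariance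

open MeasureTheory
open scoped RealInnerProductSpace
open BIJ85AxialPropagator411 BIJ85AxialMinimizer413 BIJ85SigmaForm421 BIJ85Sigma421Torus

noncomputable section

/-! ## §1  `∂G_V∂^*` and `σ_k` depend on the δ-function gauge `V` only through `∂V` -/

section Abstract

variable {E F F' : Type*} [NormedAddCommGroup E] [InnerProductSpace ℝ E] [FiniteDimensional ℝ E]
  [NormedAddCommGroup F] [InnerProductSpace ℝ F] [FiniteDimensional ℝ F]
  [NormedAddCommGroup F'] [InnerProductSpace ℝ F'] [FiniteDimensional ℝ F']

/-- The range of `∂G_V∂^*` lies in `∂V` (p09's `curlG_mem_range`, as a membership in the image submodule).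
[cite: BalabanImbrieJaffe1985, §4.2 p.310] -/
theorem curlG_mem_map (V : Submodule ℝ E) (D : E →ₗ[ℝ] F) (g : F) : curlG V D g ∈ V.map D := by
  obtain ⟨v, hv⟩ := curlG_mem_range V D g
  rw [hv]
  exact Submodule.mem_map_of_mem v.2

/-- `∂G_V∂^*` is the identity on `∂V` (p09's `curlG_apply_curl`, for members of the image submodule); no zero modes of `∂` on `V`.
[cite: BalabanImbrieJaffe1985, §4.2 p.310] -/
theorem curlG_apply_of_mem_map {V : Submodule ℝ E} {D : E →ₗ[ℝ] F} (hD : ∀ v : V, D (v : E) = 0 → v = 0)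
    {g : F} (hg : g ∈ V.map D) : curlG V D g = g := by
  obtain ⟨v, hv, rfl⟩ := Submodule.mem_map.1 hg
  exact curlG_apply_curl hD ⟨v, hv⟩

/-- **`∂G_V∂^*` depends on the gauge `V` only through `∂V`.**  For two δ-function gauges `V`, `V′` (linear subspaces of the
η-bond fields on which `∂` has no zero modes) with the same space of plaquette variables `∂V = ∂V′`, the operators
`∂G_V∂^*` and `∂G_{V′}∂^*` (`G_V = ι_V(ι_V^*∂^*∂ι_V)⁻¹ι_V^*`, the propagator (4.1.1) of the gauge `V`) COINCIDE — both are the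
orthogonal projection onto `∂V`.  This is the content of *"the combination ∂G_{k,Ax}∂^* … is invariant under a change of gauge"*.
[cite: BalabanImbrieJaffe1985, §4.2 p.310] -/
theorem curlG_eq_of_map_eq {V V' : Submodule ℝ E} {D : E →ₗ[ℝ] F}
    (hD : ∀ v : V, D (v : E) = 0 → v = 0) (hD' : ∀ v : V', D (v : E) = 0 → v = 0)
    (h : V.map D = V'.map D) : curlG V D = curlG V' D := by
  have h1 : ∀ g, curlG V' D (curlG V D g) = curlG V D g := fun g =>
    curlG_apply_of_mem_map hD' (h ▸ curlG_mem_map V D g)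
  have h2 : ∀ g, curlG V D (curlG V' D g) = curlG V' D g := fun g =>
    curlG_apply_of_mem_map hD (h.symm ▸ curlG_mem_map V' D g)
  refine LinearMap.ext fun g => ext_inner_right ℝ fun h' => ?_
  calc ⟪curlG V D g, h'⟫ = ⟪g, curlG V D h'⟫ := curlG_symm hD g h'
    _ = ⟪g, curlG V' D (curlG V D h')⟫ := by rw [h1]
    _ = ⟪curlG V' D g, curlG V D h'⟫ := (curlG_symm hD' g _).symm
    _ = ⟪curlG V D (curlG V' D g), h'⟫ := (curlG_symm hD _ h').symm
    _ = ⟪curlG V' D g, h'⟫ := by rw [h2]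

omit [FiniteDimensional ℝ E] [FiniteDimensional ℝ F] in
/-- A CHANGE OF GAUGE does not change the space of plaquette variables: if every field of the gauge `V` differs from a field of
the gauge `V′` by a gauge direction (an element of a subspace `𝒢` killed by `∂`, e.g. a gradient `∂λ`) and conversely — `V ≤ V′ ⊔ 𝒢`,
`V′ ≤ V ⊔ 𝒢`, `𝒢 ≤ ker ∂` — then `∂V = ∂V′`. [cite: BalabanImbrieJaffe1985, §4.2 p.310] -/
theorem map_eq_of_gauge {V V' G : Submodule ℝ E} {D : E →ₗ[ℝ] F} (hG : G ≤ LinearMap.ker D)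
    (hV : V ≤ V' ⊔ G) (hV' : V' ≤ V ⊔ G) : V.map D = V'.map D := by
  have hG0 : G.map D = ⊥ := LinearMap.le_ker_iff_map.1 hG
  apply le_antisymm
  · calc V.map D ≤ (V' ⊔ G).map D := Submodule.map_mono hV
      _ = V'.map D := by rw [Submodule.map_sup, hG0, sup_bot_eq]
  · calc V'.map D ≤ (V ⊔ G).map D := Submodule.map_mono hV'
      _ = V.map D := by rw [Submodule.map_sup, hG0, sup_bot_eq]

/-- **"The right side of (4.2.2) involves the combination `∂G_{k,Ax}∂^*` which is invariant under a change of gauge"** — for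
δ-function gauges: if the gauge `V′` is obtained from the gauge `V` by a change of gauge (`V ≤ V′ ⊔ 𝒢`, `V′ ≤ V ⊔ 𝒢` with gauge
directions `𝒢 ≤ ker ∂`) and `∂` has no zero modes on either, then `∂G_V∂^* = ∂G_{V′}∂^*`. [cite: BalabanImbrieJaffe1985, §4.2 p.310] -/
theorem curlG_eq_of_gauge {V V' G : Submodule ℝ E} {D : E →ₗ[ℝ] F}
    (hD : ∀ v : V, D (v : E) = 0 → v = 0) (hD' : ∀ v : V', D (v : E) = 0 → v = 0)
    (hG : G ≤ LinearMap.ker D) (hV : V ≤ V' ⊔ G) (hV' : V' ≤ V ⊔ G) : curlG V D = curlG V' D :=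
  curlG_eq_of_map_eq hD hD' (map_eq_of_gauge hG hV hV')

/-- **"Hence the gauge chosen to define σ_k is irrelevant"**, operator form: the operator (4.2.2) `Q^e_k(I − ∂G_V∂^*)Q^{e*}_k`
(p09's `sigmaOp V D Qes`) is the same for any two zero-mode-free δ-function gauges with `∂V = ∂V′`.
[cite: BalabanImbrieJaffe1985, (4.2.2) p.310] -/
theorem sigmaOp_eq_of_map_eq {V V' : Submodule ℝ E} {D : E →ₗ[ℝ] F}
    (hD : ∀ v : V, D (v : E) = 0 → v = 0) (hD' : ∀ v : V', D (v : E) = 0 → v = 0)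
    (h : V.map D = V'.map D) (Qes : F' →ₗ[ℝ] F) : sigmaOp V D Qes = sigmaOp V' D Qes := by
  unfold sigmaOp
  rw [curlG_eq_of_map_eq hD hD' h]

/-- The same under a change of gauge `V ≤ V′ ⊔ 𝒢`, `V′ ≤ V ⊔ 𝒢`, `𝒢 ≤ ker ∂`. [cite: BalabanImbrieJaffe1985, (4.2.2) p.310] -/
theorem sigmaOp_eq_of_gauge {V V' G : Submodule ℝ E} {D : E →ₗ[ℝ] F}
    (hD : ∀ v : V, D (v : E) = 0 → v = 0) (hD' : ∀ v : V', D (v : E) = 0 → v = 0)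
    (hG : G ≤ LinearMap.ker D) (hV : V ≤ V' ⊔ G) (hV' : V' ≤ V ⊔ G) (Qes : F' →ₗ[ℝ] F) :
    sigmaOp V D Qes = sigmaOp V' D Qes :=
  sigmaOp_eq_of_map_eq hD hD' (map_eq_of_gauge hG hV hV') Qes

/-- **"Hence the gauge chosen to define σ_k is irrelevant"**, at the level of the DEFINITION (4.2.1): if σ satisfies the
functional-integral identity (4.2.1) `exp(−½⟨f, σf⟩) = Z_V^{−1}∫_V exp(−½‖∂A − Q^{e*}_kf‖²)dA` with the gauge `V` and σ′ satisfies
it with the gauge `V′` (both zero-mode free, `∂V = ∂V′`), then `⟨f, σf⟩ = ⟨f, σ′f⟩` for every unit-lattice plaquette field `f`.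
[cite: BalabanImbrieJaffe1985, (4.2.1) p.310] -/
theorem form_eq_of_isSigmaForm_of_map_eq [MeasurableSpace E] [BorelSpace E] {V V' : Submodule ℝ E} {D : E →ₗ[ℝ] F}
    (hD : ∀ v : V, D (v : E) = 0 → v = 0) (hD' : ∀ v : V', D (v : E) = 0 → v = 0)
    (h : V.map D = V'.map D) {Qes : F' →ₗ[ℝ] F} {σ σ' : F' →ₗ[ℝ] F'}
    (hσ : IsSigmaForm V D Qes σ) (hσ' : IsSigmaForm V' D Qes σ') (f : F') : ⟪f, σ f⟫ = ⟪f, σ' f⟫ := by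
  rw [form_eq_of_isSigmaForm hσ (isSigmaForm_sigmaOp hD Qes), form_eq_of_isSigmaForm hσ' (isSigmaForm_sigmaOp hD' Qes),
    sigmaOp_eq_of_map_eq hD hD' h]

/-- The same under a change of gauge `V ≤ V′ ⊔ 𝒢`, `V′ ≤ V ⊔ 𝒢`, `𝒢 ≤ ker ∂`: *"the quadratic form σ_k is gauge invariant"*.
[cite: BalabanImbrieJaffe1985, (4.2.1) p.310] -/
theorem form_eq_of_isSigmaForm_of_gauge [MeasurableSpace E] [BorelSpace E] {V V' G : Submodule ℝ E} {D : E →ₗ[ℝ] F}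
    (hD : ∀ v : V, D (v : E) = 0 → v = 0) (hD' : ∀ v : V', D (v : E) = 0 → v = 0)
    (hG : G ≤ LinearMap.ker D) (hV : V ≤ V' ⊔ G) (hV' : V' ≤ V ⊔ G) {Qes : F' →ₗ[ℝ] F} {σ σ' : F' →ₗ[ℝ] F'}
    (hσ : IsSigmaForm V D Qes σ) (hσ' : IsSigmaForm V' D Qes σ') (f : F') : ⟪f, σ f⟫ = ⟪f, σ' f⟫ :=
  form_eq_of_isSigmaForm_of_map_eq hD hD' (map_eq_of_gauge hG hV hV') hσ hσ' f

end Abstract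

/-! ## §2  On the tori of the series: the k-axial gauge is accessible, and σ_k is the same for every accessible gauge -/

section Torus

open Literature.MathematicalPhysics.QuantumFieldTheory.Balaban1983to89
open LatticeFieldCalculus

variable {P : Params}

/-- Components of p09's weighted curl `curlOp w c = √w·∂`. [folklore] -/
private theorem curlOp_apply' (w c : ℝ) (v : BondSpace P) (p : Plaq P 0) :
    curlOp (P := P) w c v p = Real.sqrt w * curl c ((toE P).symm v) p := rfl

/-- A gauge transformation `A ↦ A^λ = A − ∂λ` does not change the plaquette variables: `√w·∂(A^λ) = √w·∂A` in p09's
`PlaqSpace` (the tree's `curl_gaugeShift`, [Balaban1984PropagatorsI] (1.4)). [cite: BalabanImbrieJaffe1985, §4.2 p.310] -/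
theorem curlOp_toE_gaugeShift (w c c' : ℝ) (lam : SiteField P 0 ℝ) (A : VecField P 0 ℝ) :
    curlOp (P := P) w c (toE P (gaugeShift c' lam A)) = curlOp (P := P) w c (toE P A) := by
  ext p
  rw [curlOp_apply', curlOp_apply', LinearEquiv.symm_apply_apply, LinearEquiv.symm_apply_apply, curl_gaugeShift]

/-- **The k-axial gauge is ACCESSIBLE inside the constraint `δ(Q_kA)`.**  Every η-bond field `A` with `Q_kA = 0` is carried by
a RESTRICTED gauge transformation `λ ∈ N(Q′_k)` (`Q′_kλ = 0`, so that `δ(Q_kA)` is untouched: `Q_kA^λ = Q_kA − ∂Q′_kλ = Q_kA`,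
[Balaban1984PropagatorsI] (1.20)) into the support of `δ(Q_kA)δ_{k,Ax}(A)` of (4.1.1)–(4.1.2): `A^λ = A − ∂λ ∈ constraint411 k`
— the hierarchical block-axial gauge of [Balaban1984PropagatorsI] (1.23) (the tree's `B5HierAxialGaugeV1.hierAxial_exists`);
standing range `k ≤ m + K`, gauge factor `c ≠ 0`. [cite: BalabanImbrieJaffe1985, (4.1.2) p.309] -/
theorem exists_gaugeShift_mem_constraint411 {k : ℕ} (hk : k ≤ P.m + P.K) {c : ℝ} (hc : c ≠ 0) (A : VecField P 0 ℝ)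
    (hQ : bondAvgIter k A = 0) :
    ∃ lam : SiteField P 0 ℝ, siteAvgIter k lam = 0 ∧
      gaugeShift c lam A ∈ (constraint411 k : Submodule ℝ (VecField P 0 ℝ)) := by
  obtain ⟨lam, htop, hax⟩ := B5HierAxialGaugeV1.hierAxial_exists hk hc A
  refine ⟨lam, htop, (mem_constraint411 k _).2 ⟨?_, hax⟩⟩
  rw [B5Eq120IterProof.bondAvgIter_gaugeShift_of_null hk c htop, hQ]

/-- Hence every field with `Q_kA = 0` has a representative IN THE AXIAL GAUGE `V411 P k` with the same plaquette variables
(`w`-weighted curl, curl factor `c`; the gauge transformation is taken with the same factor). [cite: BalabanImbrieJaffe1985, (4.1.2) p.309] -/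
theorem exists_mem_V411_curlOp_eq {k : ℕ} (hk : k ≤ P.m + P.K) {c : ℝ} (hc : c ≠ 0) (w : ℝ) (A : VecField P 0 ℝ)
    (hQ : bondAvgIter k A = 0) :
    ∃ v ∈ V411 P k, curlOp (P := P) w c v = curlOp (P := P) w c (toE P A) := by
  obtain ⟨lam, -, hmem⟩ := exists_gaugeShift_mem_constraint411 hk hc A hQ
  refine ⟨toE P (gaugeShift c lam A), ?_, curlOp_toE_gaugeShift w c c lam A⟩
  rw [mem_V411, LinearEquiv.symm_apply_apply]
  exact (mem_constraint411 k _).1 hmem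

/-- A gauge `V′` is ACCESSIBLE (inside `δ(Q_kA)`) when every `Q_k`-null field has a `V′`-representative with the same plaquette
variables; a GAUGE-FIXING RULE `A ↦ λ(A)` (any gauge factor `c′`) landing every `Q_k`-null field in `V′` provides one, since
gauge transformations do not change `∂A`. [cite: BalabanImbrieJaffe1985, §4.2 p.310] -/
theorem accessible_of_gaugeFixing {k : ℕ} (w c c' : ℝ) {V' : Submodule ℝ (BondSpace P)}
    (fix : VecField P 0 ℝ → SiteField P 0 ℝ)
    (hfix : ∀ A : VecField P 0 ℝ, bondAvgIter k A = 0 → toE P (gaugeShift c' (fix A) A) ∈ V') :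
    ∀ A : VecField P 0 ℝ, bondAvgIter k A = 0 → ∃ v ∈ V', curlOp (P := P) w c v = curlOp (P := P) w c (toE P A) :=
  fun A hA => ⟨_, hfix A hA, curlOp_toE_gaugeShift w c c' (fix A) A⟩

/-- **`∂(V411 k) = ∂V′` for every accessible gauge `V′` inside `{Q_kA = 0}`**: the axial gauge and any other accessible
δ-function gauge for the constraint `δ(Q_kA)` have the same space of plaquette variables (standing range, `c ≠ 0`).
[cite: BalabanImbrieJaffe1985, §4.2 p.310] -/
theorem map_curlOp_V411_eq_of_gauge {k : ℕ} (hk : k ≤ P.m + P.K) (w : ℝ) {c : ℝ} (hc : c ≠ 0)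
    {V' : Submodule ℝ (BondSpace P)}
    (hV'Q : ∀ v ∈ V', bondAvgIter k ((toE P).symm v) = 0)
    (hV'acc : ∀ A : VecField P 0 ℝ, bondAvgIter k A = 0 →
      ∃ v ∈ V', curlOp (P := P) w c v = curlOp (P := P) w c (toE P A)) :
    (V' : Submodule ℝ (BondSpace P)).map (curlOp (P := P) w c) = (V411 P k).map (curlOp (P := P) w c) := by
  apply le_antisymm
  · rintro g ⟨v, hv, rfl⟩
    obtain ⟨u, hu, hcurl⟩ := exists_mem_V411_curlOp_eq hk hc w ((toE P).symm v) (hV'Q v hv)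
    rw [LinearEquiv.apply_symm_apply] at hcurl
    exact ⟨u, hu, hcurl⟩
  · rintro g ⟨u, hu, rfl⟩
    obtain ⟨v, hv, hcurl⟩ := hV'acc ((toE P).symm u) ((mem_V411 k u).1 hu).1
    rw [LinearEquiv.apply_symm_apply] at hcurl
    exact ⟨v, hv, hcurl⟩

/-- The axial gauge `V411 P k` itself is an accessible, zero-mode-free gauge inside `{Q_kA = 0}` (accessibility:
`exists_mem_V411_curlOp_eq`; no zero modes: the p. 309 claim, this seat's `BIJ85NoZeroModes309Torus.noZeroModes_V411_holds`);
standing range, `w > 0`, `c ≠ 0`. [cite: BalabanImbrieJaffe1985, (4.1.2) p.309] -/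
theorem V411_isAccessibleGauge {k : ℕ} (hk : k ≤ P.m + P.K) {w : ℝ} (hw : 0 < w) {c : ℝ} (hc : c ≠ 0) :
    (∀ v ∈ V411 P k, bondAvgIter k ((toE P).symm v) = 0) ∧
    (∀ A : VecField P 0 ℝ, bondAvgIter k A = 0 →
      ∃ v ∈ V411 P k, curlOp (P := P) w c v = curlOp (P := P) w c (toE P A)) ∧
    (∀ v : V411 P k, curlOp (P := P) w c (v : BondSpace P) = 0 → v = 0) :=
  ⟨fun v hv => ((mem_V411 k v).1 hv).1, fun A hA => exists_mem_V411_curlOp_eq hk hc w A hA,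
    BIJ85NoZeroModes309Torus.noZeroModes_V411_holds hk hw hc⟩

/-- **"∂G_{k,Ax}∂^* is invariant under a change of gauge" ON THE TORUS.**  For every δ-function gauge `V′` inside `{Q_kA = 0}`
which is accessible and on which `∂` has no zero modes, `∂G_{V′}∂^* = ∂G_{k,Ax}∂^*` (`G_{V′}` = the propagator (4.1.1) with `V′`
in place of `δ_{k,Ax}`); standing range `k ≤ m + K`, `w > 0`, `c ≠ 0`. [cite: BalabanImbrieJaffe1985, §4.2 p.310] -/
theorem curlG_eq_curlG_V411 {k : ℕ} (hk : k ≤ P.m + P.K) {w : ℝ} (hw : 0 < w) {c : ℝ} (hc : c ≠ 0)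
    {V' : Submodule ℝ (BondSpace P)}
    (hV'Q : ∀ v ∈ V', bondAvgIter k ((toE P).symm v) = 0)
    (hV'acc : ∀ A : VecField P 0 ℝ, bondAvgIter k A = 0 →
      ∃ v ∈ V', curlOp (P := P) w c v = curlOp (P := P) w c (toE P A))
    (hV'D : ∀ v : V', curlOp (P := P) w c (v : BondSpace P) = 0 → v = 0) :
    curlG V' (curlOp (P := P) w c) = curlG (V411 P k) (curlOp (P := P) w c) :=
  curlG_eq_of_map_eq hV'D (BIJ85NoZeroModes309Torus.noZeroModes_V411_holds hk hw hc)
    (map_curlOp_V411_eq_of_gauge hk w hc hV'Q hV'acc)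

/-- **"Hence the gauge chosen to define σ_k is irrelevant" ON THE TORUS**, operator form: for every accessible, zero-mode-free
δ-function gauge `V′` inside `{Q_kA = 0}`, `Q^e_k(I − ∂G_{V′}∂^*)Q^{e*}_k = σ_k` (p30 g3's `sigmaTorus`, defined with the axial
gauge); `2 ≤ d`, standing range, `w > 0`, `c ≠ 0`. [cite: BalabanImbrieJaffe1985, (4.2.2) p.310] -/
theorem sigmaOp_eq_sigmaTorus (hd : 2 ≤ P.d) {k : ℕ} (hk : k ≤ P.m + P.K) {w : ℝ} (hw : 0 < w) {c : ℝ} (hc : c ≠ 0)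
    {V' : Submodule ℝ (BondSpace P)}
    (hV'Q : ∀ v ∈ V', bondAvgIter k ((toE P).symm v) = 0)
    (hV'acc : ∀ A : VecField P 0 ℝ, bondAvgIter k A = 0 →
      ∃ v ∈ V', curlOp (P := P) w c v = curlOp (P := P) w c (toE P A))
    (hV'D : ∀ v : V', curlOp (P := P) w c (v : BondSpace P) = 0 → v = 0) :
    sigmaOp V' (curlOp (P := P) w c) (QesOp (P := P) hd w k) = sigmaTorus (P := P) hd w c k := by
  unfold sigmaTorus sigmaOp
  rw [curlG_eq_curlG_V411 hk hw hc hV'Q hV'acc hV'D]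

/-- **"the quadratic form σ_k is gauge invariant" ON THE TORUS**, at the level of the definition (4.2.1): if σ′ satisfies
`exp(−½⟨f, σ′f⟩) = Z^{−1}∫𝒟Aδ(Q_kA)δ_{V′}(A)exp(−½‖∂A − Q^{e*}_kf‖²)` — (4.2.1) with an accessible, zero-mode-free δ-function
gauge `V′` in place of `δ_{k,Ax}` — then `⟨f, σ′f⟩ = ⟨f, σ_kf⟩` for every unit-lattice plaquette field `f`.
[cite: BalabanImbrieJaffe1985, (4.2.1) p.310] -/
theorem form_eq_sigmaTorus_of_isSigmaForm (hd : 2 ≤ P.d) {k : ℕ} (hk : k ≤ P.m + P.K) {w : ℝ} (hw : 0 < w)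
    {c : ℝ} (hc : c ≠ 0) {V' : Submodule ℝ (BondSpace P)}
    (hV'Q : ∀ v ∈ V', bondAvgIter k ((toE P).symm v) = 0)
    (hV'acc : ∀ A : VecField P 0 ℝ, bondAvgIter k A = 0 →
      ∃ v ∈ V', curlOp (P := P) w c v = curlOp (P := P) w c (toE P A))
    (hV'D : ∀ v : V', curlOp (P := P) w c (v : BondSpace P) = 0 → v = 0)
    {σ' : UnitPlaqSpace P k →ₗ[ℝ] UnitPlaqSpace P k}
    (hσ' : IsSigmaForm V' (curlOp (P := P) w c) (QesOp (P := P) hd w k) σ') (f : UnitPlaqSpace P k) :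
    ⟪f, σ' f⟫ = ⟪f, sigmaTorus (P := P) hd w c k f⟫ := by
  rw [form_eq_of_isSigmaForm hσ' (isSigmaForm_sigmaOp hV'D _), sigmaOp_eq_sigmaTorus hd hk hw hc hV'Q hV'acc hV'D]

/-- Two accessible, zero-mode-free δ-function gauges `V′`, `V″` inside `{Q_kA = 0}` define THE SAME σ_k by (4.2.1).
[cite: BalabanImbrieJaffe1985, (4.2.1) p.310] -/
theorem form_eq_of_isSigmaForm_torus (hd : 2 ≤ P.d) {k : ℕ} (hk : k ≤ P.m + P.K) {w : ℝ} (hw : 0 < w)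
    {c : ℝ} (hc : c ≠ 0) {V' V'' : Submodule ℝ (BondSpace P)}
    (hV'Q : ∀ v ∈ V', bondAvgIter k ((toE P).symm v) = 0)
    (hV'acc : ∀ A : VecField P 0 ℝ, bondAvgIter k A = 0 →
      ∃ v ∈ V', curlOp (P := P) w c v = curlOp (P := P) w c (toE P A))
    (hV'D : ∀ v : V', curlOp (P := P) w c (v : BondSpace P) = 0 → v = 0)
    (hV''Q : ∀ v ∈ V'', bondAvgIter k ((toE P).symm v) = 0)
    (hV''acc : ∀ A : VecField P 0 ℝ, bondAvgIter k A = 0 →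
      ∃ v ∈ V'', curlOp (P := P) w c v = curlOp (P := P) w c (toE P A))
    (hV''D : ∀ v : V'', curlOp (P := P) w c (v : BondSpace P) = 0 → v = 0)
    {σ' σ'' : UnitPlaqSpace P k →ₗ[ℝ] UnitPlaqSpace P k}
    (hσ' : IsSigmaForm V' (curlOp (P := P) w c) (QesOp (P := P) hd w k) σ')
    (hσ'' : IsSigmaForm V'' (curlOp (P := P) w c) (QesOp (P := P) hd w k) σ'') (f : UnitPlaqSpace P k) :
    ⟪f, σ' f⟫ = ⟪f, σ'' f⟫ := by
  rw [form_eq_sigmaTorus_of_isSigmaForm hd hk hw hc hV'Q hV'acc hV'D hσ' f,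
    form_eq_sigmaTorus_of_isSigmaForm hd hk hw hc hV''Q hV''acc hV''D hσ'' f]

end Torus

end

end Literature.MathematicalPhysics.QuantumFieldTheory.BalabanImbrieJaffe1984to88.BIJ85SigmaGaugeInvariance
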